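import Mathlib
import Summits.HodgeConjecture.HodgeConjecture.Theorems.WeilClassTestFormatFiveThreeCrossPlusTwoPieceDefsFF
import Summits.HodgeConjecture.HodgeConjecture.Theorems.WeilClassTestFormatFiveThreeCrossPlusTwoPieceExitsFF
import Summits.HodgeConjecture.HodgeConjecture.Theorems.WeilClassTestFormatFiveThreeCrossPlusTwoFaceWFFSlices
import Summits.HodgeConjecture.HodgeConjecture.Theorems.WeilClassTestFormatFiveThreeCrossPlusOneEndpoint

/-!
# Conjecture N (hodge-weil ladder, GAPS G51b), format (5,3): CROSS + TWO FREE F-ROOTS — THE k = 2 FF PIECE ASSEMBLED MODULO ITS LAST EXIT (L-H)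

Prover 2, generation 32 (note `run/shared/lean/b2b/hodge-weil/b2b-hweil-pv2-g32/PIECE-FF-G32.md`). The FF analogue of pv2-g28's `…CrossPlusTwoPiece.piece_EE_nonneg`, with the ONE
exit that has no certificate yet — (L-H), `H = 0`, the double corner DC(FF) — carried as an explicit hypothesis `hExitH` (a universally quantified implication over the
piece data; no named fact, no definition). Everything else of pv2-g24's t-ENDPOINT REDUCTION is kernel-checked here for FF: in the charge-gap coordinates `(m,t,a1,a2,u1,u2)`
of the piece (`b_i = a_i + t − u_i`, named polynomials `pW, pQ0, pH, pN` of `…PieceDefsFF`), `N` is a concave quadratic in `t` (`pN_quadratic`, leading coefficient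
`−m²(a1u1² + a2u2²) ≤ 0`); the window is `p(s) = (a1 + s − u1)·(C − s)` with `m·C = W0 + m` (so `W(C) = −m < 0`: the right end of the window is never feasible, and
no (L-∞) exit is needed — the t-range is compact, pv2-g29 `EE-REDUCED-G29.md` A.1), the constraint is `q(s) = min(b2(s), W(s), Q0(s), −H(s))`; pv2-g22's `endpoint_principle`
leaves the boundary cases `b1 = 0` / `b2 = 0` (`exit_b1_FF` / `exit_b2_FF`), `W = 0` (`exit_W_FF`), `Q0 = 0` (`exit_Q0_FF`) — all in `…PieceExitsFF` — and `H = 0` (`hExitH`).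

* `piece_FF_nonneg_of_exitH`: (∀ piece points with `W > 0`, `H = 0`: `N ≥ 0`) ⟹ for every piece point (`m > 0`, `a_i ≥ 0`, `b_i ≥ 0`, `W > 0`, `Q0 ≥ 0`, `H ≤ 0`): **`N ≥ 0`**.

So the FF piece of real Conjecture N (5,3), k = 2 is CLOSED MODULO DC(FF): once `exit_H_FF` (the FF analogue of `…DoubleCornerClosed.dc2_corner_nonneg_reduced` transported by
`piece_point_FF`) is a theorem, `piece_FF_nonneg` is `piece_FF_nonneg_of_exitH exit_H_FF`. `exit_Q0_FF` is computational (through pv2-g31's certificate), hence so is this file.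
Nothing here is a case of HC, a rung or a door edge; no statement of Markman's papers is used. New cell result ⇒ Summits/.
-/

set_option linter.dupNamespace false
set_option maxRecDepth 16384

namespace Summit.HodgeConjecture.HodgeConjecture.WeilClassTestFormatFiveThreeCrossPlusTwoPieceFFOfExitH

open Summit.HodgeConjecture.HodgeConjecture.WeilClassTestFormatFiveThreeCrossPlusTwoPieceDefsFF
open Summit.HodgeConjecture.HodgeConjecture.WeilClassTestFormatFiveThreeCrossPlusTwoPieceExitsFF (exit_b1_FF exit_b2_FF exit_W_FF exit_Q0_FF)
open Summit.HodgeConjecture.HodgeConjecture.WeilClassTestFormatFiveThreeCrossPlusTwoFaceWFFSlices (pH_tpoly)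
open Summit.HodgeConjecture.HodgeConjecture.WeilClassTestFormatFiveThreeCrossPlusOneEndpoint (endpoint_principle)

/-- `W = W0 − m·s` (`ring`). -/
theorem pW_affine (m s a1 a2 : ℝ) : pW m s a1 a2 = ((2:ℝ)*a2^(2:ℕ) + (2:ℝ)*a1*a2 + (2:ℝ)*a1^(2:ℕ) + (2:ℝ)*m*a2 + (2:ℝ)*m*a1 + m^(2:ℕ)) - m * s := by
  rw [pW_eq]; ring

/-- continuity of `s ↦ W(s)`. -/
theorem continuous_pW (m a1 a2 : ℝ) : Continuous fun s : ℝ => pW m s a1 a2 := by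
  simp only [pW_eq]; fun_prop

/-- continuity of `s ↦ Q0(s)`. -/
theorem continuous_pQ0 (m a1 a2 u1 u2 : ℝ) : Continuous fun s : ℝ => pQ0 m s a1 a2 u1 u2 := by
  simp only [pQ0_eq]; fun_prop

set_option maxHeartbeats 4000000 in
/-- continuity of `s ↦ H(s)` (via the t-sliced form `…FaceWFFSlices.pH_tpoly`, so that `fun_prop` sees a quintic in `s` with `s`-free coefficients — the expanded 1325-term form makes `fun_prop` time out). -/
theorem continuous_pH (m a1 a2 u1 u2 : ℝ) : Continuous fun s : ℝ => pH m s a1 a2 u1 u2 := by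
  simp only [pH_tpoly]; fun_prop

set_option maxHeartbeats 4000000 in
/-- **THE k = 2 FF PIECE OF REAL CONJECTURE N IN FORMAT (5,3), MODULO ITS EXIT (L-H).** If the double-corner exit holds (`hExitH`: at every feasible piece point with
`W > 0` and `H = 0`, `N ≥ 0`), then on the whole piece: `m > 0`, `a_i ≥ 0`, `b_i = a_i + t − u_i ≥ 0`, `W > 0`, `Q0 ≥ 0`, `H ≤ 0` ⟹ `N ≥ 0`. -/
theorem piece_FF_nonneg_of_exitH
    (hExitH : ∀ m t a1 a2 u1 u2 : ℝ, (0:ℝ) < m → (0:ℝ) ≤ a1 → (0:ℝ) ≤ a2 → (0:ℝ) ≤ a1 + t - u1 → (0:ℝ) ≤ a2 + t - u2 →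
      (0:ℝ) < pW m t a1 a2 → (0:ℝ) ≤ pQ0 m t a1 a2 u1 u2 → pH m t a1 a2 u1 u2 ≤ (0:ℝ) → pH m t a1 a2 u1 u2 = 0 → (0:ℝ) ≤ pN m t a1 a2 u1 u2)
    (m t a1 a2 u1 u2 : ℝ) (hm : (0:ℝ) < m) (ha1 : (0:ℝ) ≤ a1) (ha2 : (0:ℝ) ≤ a2)
    (hb1 : (0:ℝ) ≤ a1 + t - u1) (hb2 : (0:ℝ) ≤ a2 + t - u2)
    (hW : (0:ℝ) < pW m t a1 a2) (hQ : (0:ℝ) ≤ pQ0 m t a1 a2 u1 u2) (hH : pH m t a1 a2 u1 u2 ≤ (0:ℝ)) :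
    (0:ℝ) ≤ pN m t a1 a2 u1 u2 := by
  -- the right end of the window: m·C = W0 + m, W(C) = −m < 0
  have hm0 : m ≠ 0 := hm.ne'
  obtain ⟨C, hC⟩ : ∃ C : ℝ, m * C = ((2:ℝ)*a2^(2:ℕ) + (2:ℝ)*a1*a2 + (2:ℝ)*a1^(2:ℕ) + (2:ℝ)*m*a2 + (2:ℝ)*m*a1 + m^(2:ℕ)) + m :=
    ⟨(((2:ℝ)*a2^(2:ℕ) + (2:ℝ)*a1*a2 + (2:ℝ)*a1^(2:ℕ) + (2:ℝ)*m*a2 + (2:ℝ)*m*a1 + m^(2:ℕ)) + m) / m, by field_simp⟩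
  -- W(s) ≥ 0 ⟹ 0 < C − s
  have hCs : ∀ s : ℝ, (0:ℝ) ≤ pW m s a1 a2 → (0:ℝ) < C - s := by
    intro s hs
    rw [pW_affine] at hs
    have h1 : (0:ℝ) < m * (C - s) := by nlinarith
    exact (mul_pos_iff_of_pos_left hm).mp h1
  have hP : ∀ s : ℝ, (fun s : ℝ => (a1 + s - u1) * (C - s)) s = 0 → (0:ℝ) ≤ (fun s : ℝ => min (a2 + s - u2) (min (pW m s a1 a2) (min (pQ0 m s a1 a2 u1 u2) (-(pH m s a1 a2 u1 u2))))) s →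
      (0:ℝ) ≤ (fun s : ℝ => pN m s a1 a2 u1 u2) s := by
    intro s hps hqs
    change (a1 + s - u1) * (C - s) = 0 at hps
    change (0:ℝ) ≤ min (a2 + s - u2) (min (pW m s a1 a2) (min (pQ0 m s a1 a2 u1 u2) (-(pH m s a1 a2 u1 u2)))) at hqs
    change (0:ℝ) ≤ pN m s a1 a2 u1 u2
    simp only [le_min_iff] at hqs
    obtain ⟨hb2s, hWs, hQs, hHs⟩ := hqs
    have hHs' : pH m s a1 a2 u1 u2 ≤ 0 := by linarith
    rcases mul_eq_zero.mp hps with h1 | h2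
    · rcases hWs.eq_or_lt with hW0 | hWp
      · exact exit_W_FF m s a1 a2 u1 u2 hm ha1 ha2 (le_of_eq h1.symm) hb2s hW0.symm hQs hHs'
      · exact exit_b1_FF m s a1 a2 u1 u2 hm ha1 ha2 (le_of_eq h1.symm) hb2s hWp hQs hHs' h1
    · have hsC : (0:ℝ) < C - s := hCs s hWs
      linarith
  have hQ' : ∀ s : ℝ, (fun s : ℝ => min (a2 + s - u2) (min (pW m s a1 a2) (min (pQ0 m s a1 a2 u1 u2) (-(pH m s a1 a2 u1 u2))))) s = 0 → (0:ℝ) ≤ (fun s : ℝ => (a1 + s - u1) * (C - s)) s →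
      (0:ℝ) ≤ (fun s : ℝ => pN m s a1 a2 u1 u2) s := by
    intro s hqs hps
    change min (a2 + s - u2) (min (pW m s a1 a2) (min (pQ0 m s a1 a2 u1 u2) (-(pH m s a1 a2 u1 u2)))) = 0 at hqs
    change (0:ℝ) ≤ (a1 + s - u1) * (C - s) at hps
    change (0:ℝ) ≤ pN m s a1 a2 u1 u2
    have hall : (0:ℝ) ≤ min (a2 + s - u2) (min (pW m s a1 a2) (min (pQ0 m s a1 a2 u1 u2) (-(pH m s a1 a2 u1 u2)))) := le_of_eq hqs.symm
    simp only [le_min_iff] at hall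
    obtain ⟨hb2s, hWs, hQs, hHs⟩ := hall
    have hHs' : pH m s a1 a2 u1 u2 ≤ 0 := by linarith
    have hsC : (0:ℝ) < C - s := hCs s hWs
    have hb1s : (0:ℝ) ≤ a1 + s - u1 := (mul_nonneg_iff_of_pos_right hsC).mp hps
    rcases hWs.eq_or_lt with hW0 | hWp
    · exact exit_W_FF m s a1 a2 u1 u2 hm ha1 ha2 hb1s hb2s hW0.symm hQs hHs'
    rcases min_eq_iff.mp hqs with ⟨hb2z, _⟩ | ⟨hrest, _⟩
    · exact exit_b2_FF m s a1 a2 u1 u2 hm ha1 ha2 hb1s hb2s hWp hQs hHs' hb2z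
    rcases min_eq_iff.mp hrest with ⟨hWz, _⟩ | ⟨hrest2, _⟩
    · exact absurd hWz hWp.ne'
    rcases min_eq_iff.mp hrest2 with ⟨hQz, _⟩ | ⟨hHz, _⟩
    · exact exit_Q0_FF m s a1 a2 u1 u2 hm ha1 ha2 hb1s hb2s hWp hQs hHs' hQz
    · exact hExitH m s a1 a2 u1 u2 hm ha1 ha2 hb1s hb2s hWp hQs hHs' (by linarith)
  have hcont : Continuous (fun s : ℝ => min (a2 + s - u2) (min (pW m s a1 a2) (min (pQ0 m s a1 a2 u1 u2) (-(pH m s a1 a2 u1 u2))))) := by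
    have h1 : Continuous fun s : ℝ => a2 + s - u2 := by fun_prop
    have h2 := continuous_pW m a1 a2
    have h3 := continuous_pQ0 m a1 a2 u1 u2
    have h4 : Continuous fun s : ℝ => -(pH m s a1 a2 u1 u2) := (continuous_pH m a1 a2 u1 u2).neg
    exact h1.min (h2.min (h3.min h4))
  have hCt : (0:ℝ) < C - t := hCs t hW.le
  have key := endpoint_principle (fun s : ℝ => pN m s a1 a2 u1 u2) (fun s : ℝ => (a1 + s - u1) * (C - s)) (fun s : ℝ => min (a2 + s - u2) (min (pW m s a1 a2) (min (pQ0 m s a1 a2 u1 u2) (-(pH m s a1 a2 u1 u2)))))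
      (-(1:ℝ)*m^(2:ℕ)*a2*u2^(2:ℕ) - (1:ℝ)*m^(2:ℕ)*a1*u1^(2:ℕ)) (-(6:ℝ)*m*a2^(3:ℕ)*u2^(2:ℕ) + (3:ℝ)*m*a1*a2*u2^(3:ℕ) - (3:ℝ)*m*a1*a2*u1*u2^(2:ℕ) - (3:ℝ)*m*a1*a2*u1^(2:ℕ)*u2 + (3:ℝ)*m*a1*a2*u1^(3:ℕ) - (6:ℝ)*m*a1*a2^(2:ℕ)*u2^(2:ℕ) - (8:ℝ)*m*a1*a2^(2:ℕ)*u1*u2 + (2:ℝ)*m*a1*a2^(2:ℕ)*u1^(2:ℕ) + (2:ℝ)*m*a1^(2:ℕ)*a2*u2^(2:ℕ) - (8:ℝ)*m*a1^(2:ℕ)*a2*u1*u2 - (6:ℝ)*m*a1^(2:ℕ)*a2*u1^(2:ℕ) - (6:ℝ)*m*a1^(3:ℕ)*u1^(2:ℕ) + (3:ℝ)*m^(2:ℕ)*a2*u2^(3:ℕ) - (6:ℝ)*m^(2:ℕ)*a2^(2:ℕ)*u2^(2:ℕ) + (3:ℝ)*m^(2:ℕ)*a1*u1^(3:ℕ)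 - (6:ℝ)*m^(2:ℕ)*a1*a2*u1*u2 - (6:ℝ)*m^(2:ℕ)*a1^(2:ℕ)*u1^(2:ℕ)) ((6:ℝ)*a1*a2^(3:ℕ)*u2^(3:ℕ) - (18:ℝ)*a1*a2^(3:ℕ)*u1*u2^(2:ℕ) + (18:ℝ)*a1*a2^(3:ℕ)*u1^(2:ℕ)*u2 - (6:ℝ)*a1*a2^(3:ℕ)*u1^(3:ℕ) + (12:ℝ)*a1^(2:ℕ)*a2^(3:ℕ)*u2^(2:ℕ) - (24:ℝ)*a1^(2:ℕ)*a2^(3:ℕ)*u1*u2 + (12:ℝ)*a1^(2:ℕ)*a2^(3:ℕ)*u1^(2:ℕ) - (6:ℝ)*a1^(3:ℕ)*a2*u2^(3:ℕ) + (18:ℝ)*a1^(3:ℕ)*a2*u1*u2^(2:ℕ) - (18:ℝ)*a1^(3:ℕ)*a2*u1^(2:ℕ)*u2 + (6:ℝ)*a1^(3:ℕ)*a2*u1^(3:ℕ) + (12:ℝ)*a1^(3:ℕ)*a2^(2:ℕ)*u2^(2:ℕ) - (24:ℝ)*a1^(3:ℕ)*a2^(2:ℕ)*u1*u2 + (12:ℝ)*a1^(3:ℕ)*a2^(2:ℕ)*u1^(2:ℕ)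 + (6:ℝ)*m*a2^(3:ℕ)*u2^(3:ℕ) + (24:ℝ)*m*a1*a2^(2:ℕ)*u1^(2:ℕ)*u2 - (12:ℝ)*m*a1*a2^(2:ℕ)*u1^(3:ℕ) + (12:ℝ)*m*a1*a2^(3:ℕ)*u2^(2:ℕ) - (12:ℝ)*m*a1*a2^(3:ℕ)*u1*u2 + (4:ℝ)*m*a1*a2^(3:ℕ)*u1^(2:ℕ) - (12:ℝ)*m*a1^(2:ℕ)*a2*u2^(3:ℕ) + (24:ℝ)*m*a1^(2:ℕ)*a2*u1*u2^(2:ℕ) + (24:ℝ)*m*a1^(2:ℕ)*a2^(2:ℕ)*u2^(2:ℕ) - (44:ℝ)*m*a1^(2:ℕ)*a2^(2:ℕ)*u1*u2 + (24:ℝ)*m*a1^(2:ℕ)*a2^(2:ℕ)*u1^(2:ℕ) + (6:ℝ)*m*a1^(3:ℕ)*u1^(3:ℕ) + (4:ℝ)*m*a1^(3:ℕ)*a2*u2^(2:ℕ) - (12:ℝ)*m*a1^(3:ℕ)*a2*u1*u2 + (12:ℝ)*m*a1^(3:ℕ)*a2*u1^(2:ℕ) + (6:ℝ)*m^(2:ℕ)*a2^(3:ℕ)*u2^(2:ℕ)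 - (9:ℝ)*m^(2:ℕ)*a1*a2*u2^(3:ℕ) + (9:ℝ)*m^(2:ℕ)*a1*a2*u1*u2^(2:ℕ) + (9:ℝ)*m^(2:ℕ)*a1*a2*u1^(2:ℕ)*u2 - (9:ℝ)*m^(2:ℕ)*a1*a2*u1^(3:ℕ) + (18:ℝ)*m^(2:ℕ)*a1*a2^(2:ℕ)*u2^(2:ℕ) - (12:ℝ)*m^(2:ℕ)*a1*a2^(2:ℕ)*u1*u2 + (6:ℝ)*m^(2:ℕ)*a1*a2^(2:ℕ)*u1^(2:ℕ) + (6:ℝ)*m^(2:ℕ)*a1^(2:ℕ)*a2*u2^(2:ℕ) - (12:ℝ)*m^(2:ℕ)*a1^(2:ℕ)*a2*u1*u2 + (18:ℝ)*m^(2:ℕ)*a1^(2:ℕ)*a2*u1^(2:ℕ) + (6:ℝ)*m^(2:ℕ)*a1^(3:ℕ)*u1^(2:ℕ) - (3:ℝ)*m^(3:ℕ)*a2*u2^(3:ℕ) + (6:ℝ)*m^(3:ℕ)*a2^(2:ℕ)*u2^(2:ℕ) - (3:ℝ)*m^(3:ℕ)*a1*u1^(3:ℕ) + (4:ℝ)*m^(3:ℕ)*a1*a2*u2^(2:ℕ)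 - (2:ℝ)*m^(3:ℕ)*a1*a2*u1*u2 + (4:ℝ)*m^(3:ℕ)*a1*a2*u1^(2:ℕ) + (6:ℝ)*m^(3:ℕ)*a1^(2:ℕ)*u1^(2:ℕ) + (1:ℝ)*m^(4:ℕ)*a2*u2^(2:ℕ) + (1:ℝ)*m^(4:ℕ)*a1*u1^(2:ℕ)) (C - a1 + u1) (C * (a1 - u1))
      (by nlinarith [mul_nonneg (mul_nonneg (sq_nonneg m) ha2) (sq_nonneg u2), mul_nonneg (mul_nonneg (sq_nonneg m) ha1) (sq_nonneg u1)])
      (fun s => pN_quadratic m s a1 a2 u1 u2)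
      (fun s => by show (a1 + s - u1) * (C - s) = _; ring)
      hcont hP hQ' t (show (0:ℝ) ≤ (a1 + t - u1) * (C - t) from mul_nonneg hb1 hCt.le)
      (show (0:ℝ) ≤ min (a2 + t - u2) (min (pW m t a1 a2) (min (pQ0 m t a1 a2 u1 u2) (-(pH m t a1 a2 u1 u2)))) from
        le_min hb2 (le_min hW.le (le_min hQ (neg_nonneg.mpr hH))))
  exact key

end Summit.HodgeConjecture.HodgeConjecture.WeilClassTestFormatFiveThreeCrossPlusTwoPieceFFOfExitH
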